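import Literature.MathematicalPhysics.QuantumFieldTheory.Balaban1983to89.T4InputCauchyRateData

/-!
# NE5 ∕ U3 — MI-R IS CONSTRUCTIBLE: causal table maps have unique fixed points, so `RepresentsA` ∕ `RepresentsB` hold for the
# RECURSIVELY DEFINED outputs of any step model with blind insertions (skeleton `t4/skeletons/NE5-t4-ne5-p2.md` §6 row A2;
# the generic tool for row O1-e of `t4/b2b-balaban-t4-ne5-p1/O1-CLAIM-TABLE-NE5-P1.md`)

Cell `pub-balaban`, unit `b2b-balaban-t4-ne5-p2-g17` (T⁴ fan-out NE5 ∕ node U3, PROVER seat P2).  Summits-side new work under the LEAN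
PLACEMENT RULE (cell bookkeeping; NOT a Literature module).  HONEST FRAMING: rung (B)+1 of the FINITE-VOLUME T⁴ continuum programme —
NOT infinite volume, NOT a mass gap, NOT the Clay problem, NOT a proof of NE5 (NOT PRINTED in [Balaban1987RG1]–[Balaban1989LargeFieldII];
they print ε-UNIFORM bounds, never η-RATES).  HONEST DEPENDENCY (cell line, verbatim): continuum YM on T⁴ ⇐ BetaPertH ∧ nine spine
estimates (0/9 proved); BetaPertH ⇐ (D1) ∧ (D4) ∧ CAP+tail; G-an2-4 gates asym, D1 and NE2/3/4.

WHAT THIS FILE DOES.  The two-run IDENTIFICATION leaves of node NE5 (skeleton L01∕L02 = the row owner's L01–L02: `StepModel.RepresentsA`,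
`StepModel.RepresentsB` — «run X's scale-k term IS the step map `Out k` applied to run X's own data, whose history entry is the
insertion of run X's OWN table of earlier outputs») are SELF-REFERENTIAL: the table feeds the insertion that produces the table.
Print's structure makes the self-reference CAUSAL — the step-`k` fluctuation action is assembled from the EARLIER actions only
([Balaban1988RG2Cluster] Lemma 1 (1.33) p. 9, Lemma 2 (1.41) p. 11; [Balaban1987RG1] (0.28)–(0.30) p. 258), typed as `StepModel.InsBlind`
(run A) and here `InsBlindB` (run B, the same shape).  We prove, with no estimate anywhere:
* §1 (generic, [folklore]) a map `Φ : (Dom → ℝ) → (Dom → ℝ)` that is CAUSAL for a scale `scale : Dom → ℕ` (`Φ t X` depends only on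
  `t` below `scale X`) has a fixed point `causalFix scale Φ` (`causalFix_isFixedPt`: the iterates from `0` stabilise at `X` after
  `scale X + 1` steps) and AT MOST ONE fixed point (`eq_of_isFixedPt`);
* §2 run B: for ANY step model `M` whose run-B insertion is blind on the window, the recursively defined functional `recB M`
  satisfies `M.RepresentsB (recB M) W` (`representsB_recB`), and ANY `EB` with `M.RepresentsB EB W` agrees with it on the window
  (`eq_recB_of_representsB`) — MI-R-B is DEFINITIONAL;
* §3 run A: the same at transported backgrounds, under the reading hypothesis `ReadsTransported` (run A's operator data and
  insertion maps at `U` depend on `U` only through `C.transport U` — how `T4OutputRate.Carriers` pairs the runs: run A's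
  background IS the transported one): `representsA_recA`, `eq_recA_of_representsA`.
CONSEQUENCE for the swarm (trigger `t4/T4-NE5-TRIGGER.json` c1, claim table row O1-e «the recursion's well-foundedness in the scale is
the one technical point»): once O1-a–d type Bałaban's step as a `StepModel` with blind insertions, `RepresentsA ∕ RepresentsB` hold
BY CONSTRUCTION for `recA ∕ recB` and characterise E^{(k)} uniquely; L01∕L02 carry no inequality and cannot hide an estimate.
Route P2 inherits this through `ActivityStepJunction.ReadsStep` (the activity model reads the step model).  STATUS: every
hypothesis is printed STRUCTURE (blindness) or a READING (`ReadsTransported`); nothing of the manuscripts under audit is asserted;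
they are cited for KIND∕locus only.  0 sorry; no new axioms.
-/

namespace Summit.QuantumFields.BalabanUV.T4Continuum.StepRecursion

open Literature.MathematicalPhysics.QuantumFieldTheory.Balaban1983to89.T4OutputRate (Carriers Functional)
open Literature.MathematicalPhysics.QuantumFieldTheory.Balaban1983to89.T4InputCauchyRateData (StepModel tableA tableB)

/-! ## §1 Causal maps on tables: existence and uniqueness of the fixed point [folklore] -/

section Causal

variable {Dom : Type*} (scale : Dom → ℕ)

/-- [folklore] `Φ` is CAUSAL for `scale`: its value at `X` depends only on the table entries of scale `< scale X`. -/
def Causal (Φ : (Dom → ℝ) → (Dom → ℝ)) : Prop :=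
  ∀ t t' : Dom → ℝ, ∀ X, (∀ Y, scale Y < scale X → t Y = t' Y) → Φ t X = Φ t' X

/-- [folklore] The candidate fixed point: at `X`, the `(scale X + 1)`-st iterate of `Φ` from the zero table. -/
def causalFix (Φ : (Dom → ℝ) → (Dom → ℝ)) : Dom → ℝ := fun X => (Φ^[scale X + 1]) 0 X

variable {scale} {Φ : (Dom → ℝ) → (Dom → ℝ)}

/-- [folklore] The iterates from `0` stabilise: entries of scale `< n` do not move after step `n`. -/
theorem iterate_succ_eq_of_lt (hΦ : Causal scale Φ) : ∀ n : ℕ, ∀ X, scale X < n → (Φ^[n + 1]) 0 X = (Φ^[n]) 0 X := by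
  intro n
  induction n with
  | zero => intro X hX; exact absurd hX (Nat.not_lt_zero _)
  | succ n ih =>
    intro X hX
    have h1 : (Φ^[n + 1 + 1]) 0 X = Φ ((Φ^[n + 1]) 0) X := by rw [Function.iterate_succ_apply']
    have h2 : (Φ^[n + 1]) 0 X = Φ ((Φ^[n]) 0) X := by rw [Function.iterate_succ_apply']
    rw [h1, h2]
    exact hΦ _ _ X fun Y hY => ih Y (lt_of_lt_of_le hY (Nat.lt_succ_iff.1 hX))

/-- [folklore] Every iterate from step `scale X + 1` on agrees with the candidate at `X`. -/
theorem iterate_add_eq_causalFix (hΦ : Causal scale Φ) (X : Dom) :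
    ∀ d : ℕ, (Φ^[scale X + 1 + d]) 0 X = causalFix scale Φ X := by
  intro d
  induction d with
  | zero => rfl
  | succ d ih =>
    rw [← ih]
    exact iterate_succ_eq_of_lt hΦ (scale X + 1 + d) X (by omega)

/-- [folklore] Every iterate past `scale X` agrees with the candidate at `X`. -/
theorem iterate_eq_causalFix (hΦ : Causal scale Φ) {n : ℕ} {X : Dom} (hX : scale X < n) :
    (Φ^[n]) 0 X = causalFix scale Φ X := by
  obtain ⟨d, rfl⟩ := Nat.exists_eq_add_of_le (Nat.succ_le_of_lt hX)
  exact iterate_add_eq_causalFix hΦ X d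

/-- [folklore] **Existence**: the candidate IS a fixed point of a causal map. -/
theorem causalFix_isFixedPt (hΦ : Causal scale Φ) : Φ (causalFix scale Φ) = causalFix scale Φ := by
  funext X
  have h1 : Φ (causalFix scale Φ) X = Φ ((Φ^[scale X + 1]) 0) X :=
    hΦ _ _ X fun Y hY => (iterate_eq_causalFix hΦ (Nat.lt_succ_of_lt hY)).symm
  rw [h1, ← Function.iterate_succ_apply' Φ (scale X + 1)]
  exact iterate_succ_eq_of_lt hΦ _ X (Nat.lt_succ_self _)

/-- [folklore] **Uniqueness**: a causal map has at most one fixed point. -/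
theorem eq_of_isFixedPt (hΦ : Causal scale Φ) {t t' : Dom → ℝ} (ht : Φ t = t) (ht' : Φ t' = t') : t = t' := by
  suffices h : ∀ n : ℕ, ∀ X, scale X < n → t X = t' X from funext fun X => h _ X (Nat.lt_succ_self _)
  intro n
  induction n with
  | zero => intro X hX; exact absurd hX (Nat.not_lt_zero _)
  | succ n ih =>
    intro X hX
    rw [← congrFun ht X, ← congrFun ht' X]
    exact hΦ t t' X fun Y hY => ih Y (lt_of_lt_of_le hY (Nat.lt_succ_iff.1 hX))

/-- [folklore] Pointwise form of uniqueness: two fixed points agree everywhere. -/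
theorem apply_eq_of_isFixedPt (hΦ : Causal scale Φ) {t t' : Dom → ℝ} (ht : Φ t = t) (ht' : Φ t' = t') (X : Dom) :
    t X = t' X := congrFun (eq_of_isFixedPt hΦ ht ht') X

end Causal

/-! ## §2 Run B: the recursively defined output and `RepresentsB` by construction -/

section Runs

variable {C : Carriers} {Op Hist : Type*} [NormedAddCommGroup Op] [NormedSpace ℂ Op] [NormedAddCommGroup Hist]
  [NormedSpace ℂ Hist] (M : StepModel C Op Hist)

/-- [folklore] Run B's one-step map on tables at data `(g, U)`: `t ↦ (X ↦ Re Out (scale X) (opB) (insB t) X)` — the right-hand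
side of `StepModel.RepresentsB`. -/
def stepMapB (g : ℕ → ℝ) (U : C.BgB) (t : C.Dom → ℝ) : C.Dom → ℝ :=
  fun X => (M.Out (C.scale X) (M.opB g U (C.scale X)) (M.insB g U (C.scale X) t) X).re

/-- [folklore] Run A's one-step map on tables at data `(g, U)` (transported background): the right-hand side of
`StepModel.RepresentsA`. -/
def stepMapA (g : ℕ → ℝ) (U : C.BgB) (t : C.Dom → ℝ) : C.Dom → ℝ :=
  fun X => (M.Out (C.scale X) (M.opA g U (C.scale X)) (M.insA g U (C.scale X) t) X).re

/-- [folklore] HYPOTHESIS SHAPE (printed STRUCTURE, the run-B twin of `StepModel.InsBlind`: [Balaban1988RG2Cluster] (1.33) p. 9,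
(1.41) p. 11 — the step reads only EARLIER actions): run B's step-`k` insertion reads only table entries of scale `< k`. -/
def InsBlindB (W : Set (ℕ → ℝ)) : Prop :=
  ∀ k, ∀ g ∈ W, ∀ (U : C.BgB) (t t' : C.Dom → ℝ), (∀ Y, C.scale Y < k → t Y = t' Y) → M.insB g U k t = M.insB g U k t'

variable {M}

/-- [folklore] Blind insertions make run B's step map causal. -/
theorem causal_stepMapB {W : Set (ℕ → ℝ)} (hblind : InsBlindB M W) {g : ℕ → ℝ} (hg : g ∈ W) (U : C.BgB) :
    Causal C.scale (stepMapB M g U) := by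
  intro t t' X htt'
  simp only [stepMapB, hblind (C.scale X) g hg U t t' htt']

/-- [folklore] Blind insertions make run A's step map causal. -/
theorem causal_stepMapA {W : Set (ℕ → ℝ)} (hblind : M.InsBlind W) {g : ℕ → ℝ} (hg : g ∈ W) (U : C.BgB) :
    Causal C.scale (stepMapA M g U) := by
  intro t t' X htt'
  simp only [stepMapA, hblind (C.scale X) g hg U t t' htt']

variable (M)

/-- [folklore] **Run B's output DEFINED by the renormalisation-group recursion** (the causal fixed point of `stepMapB`). -/
def recB : Functional C C.BgB := fun g U => causalFix C.scale (stepMapB M g U)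

/-- [folklore] `tableB` of the recursive output is the fixed-point table. -/
theorem tableB_recB (g : ℕ → ℝ) (U : C.BgB) : tableB (recB M) g U = causalFix C.scale (stepMapB M g U) := rfl

variable {M}

/-- [folklore] **MI-R-B BY CONSTRUCTION**: with blind run-B insertions, the recursively defined output satisfies `RepresentsB`. -/
theorem representsB_recB {W : Set (ℕ → ℝ)} (hblind : InsBlindB M W) : M.RepresentsB (recB M) W := by
  intro g hg U X
  have hfix := causalFix_isFixedPt (causal_stepMapB hblind hg U)
  exact (congrFun hfix X).symm

/-- [folklore] **MI-R-B IS DEFINITIONAL**: any functional satisfying `RepresentsB` on the window IS the recursive one there. -/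
theorem eq_recB_of_representsB {W : Set (ℕ → ℝ)} (hblind : InsBlindB M W) {EB : Functional C C.BgB}
    (hEB : M.RepresentsB EB W) {g : ℕ → ℝ} (hg : g ∈ W) (U : C.BgB) (X : C.Dom) : EB g U X = recB M g U X := by
  have hfixE : stepMapB M g U (tableB EB g U) = tableB EB g U := funext fun Y => (hEB g hg U Y).symm
  have hfixR := causalFix_isFixedPt (causal_stepMapB hblind hg U)
  exact apply_eq_of_isFixedPt (causal_stepMapB hblind hg U) hfixE hfixR X

/-- [folklore] Hence two functionals both satisfying `RepresentsB` agree on the window. -/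
theorem representsB_unique {W : Set (ℕ → ℝ)} (hblind : InsBlindB M W) {EB EB' : Functional C C.BgB}
    (hEB : M.RepresentsB EB W) (hEB' : M.RepresentsB EB' W) {g : ℕ → ℝ} (hg : g ∈ W) (U : C.BgB) (X : C.Dom) :
    EB g U X = EB' g U X := by
  rw [eq_recB_of_representsB hblind hEB hg U X, eq_recB_of_representsB hblind hEB' hg U X]

/-! ## §3 Run A: the same at transported backgrounds -/

variable (M)

/-- [folklore] HYPOTHESIS SHAPE (a READING, how the carriers pair the runs — `T4OutputRate.Carriers.transport`; no estimate):
run A's operator data and insertion maps at the run-B background `U` depend on `U` only through the transported background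
`C.transport U` (run A's step is READ at the transported background). -/
def ReadsTransported (W : Set (ℕ → ℝ)) : Prop :=
  ∀ g ∈ W, ∀ U U' : C.BgB, C.transport U = C.transport U' →
    (∀ k, M.opA g U k = M.opA g U' k) ∧ ∀ k (t : C.Dom → ℝ), M.insA g U k t = M.insA g U' k t

/-- [folklore] Run A's recursive table at data `(g, U)`. -/
def recTableA (g : ℕ → ℝ) (U : C.BgB) : C.Dom → ℝ := causalFix C.scale (stepMapA M g U)

open Classical in
/-- [folklore] **Run A's output DEFINED by the recursion**, as a functional of run-A backgrounds: at a transported background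
the recursive table of any preimage (well defined under `ReadsTransported`), `0` off the image of the transport (never read). -/
noncomputable def recA : Functional C C.BgA := fun g V X =>
  if h : ∃ U : C.BgB, C.transport U = V then recTableA M g (Classical.choose h) X else 0

variable {M}

/-- [folklore] Under the reading, the step maps of two preimages of one transported background coincide. -/
theorem stepMapA_eq_of_transport_eq {W : Set (ℕ → ℝ)} (hread : ReadsTransported M W) {g : ℕ → ℝ} (hg : g ∈ W)
    {U U' : C.BgB} (hUU' : C.transport U = C.transport U') : stepMapA M g U = stepMapA M g U' := by
  funext t X
  obtain ⟨hop, hins⟩ := hread g hg U U' hUU'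
  simp only [stepMapA, hop, hins]

/-- [folklore] `recA` at a transported background is the recursive table of that background. -/
theorem recA_transport {W : Set (ℕ → ℝ)} (hread : ReadsTransported M W) {g : ℕ → ℝ} (hg : g ∈ W) (U : C.BgB)
    (X : C.Dom) : recA M g (C.transport U) X = recTableA M g U X := by
  have h : ∃ U' : C.BgB, C.transport U' = C.transport U := ⟨U, rfl⟩
  unfold recA
  rw [dif_pos h]
  unfold recTableA
  rw [stepMapA_eq_of_transport_eq hread hg (Classical.choose_spec h)]

/-- [folklore] `tableA` of the recursive output at `U` is run A's recursive table at `U`. -/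
theorem tableA_recA {W : Set (ℕ → ℝ)} (hread : ReadsTransported M W) {g : ℕ → ℝ} (hg : g ∈ W) (U : C.BgB) :
    tableA (recA M) g U = recTableA M g U :=
  funext fun Y => recA_transport hread hg U Y

/-- [folklore] **MI-R-A BY CONSTRUCTION**: with blind run-A insertions read at transported backgrounds, `RepresentsA (recA M) W`. -/
theorem representsA_recA {W : Set (ℕ → ℝ)} (hblind : M.InsBlind W) (hread : ReadsTransported M W) :
    M.RepresentsA (recA M) W := by
  intro g hg U X
  rw [recA_transport hread hg U X, tableA_recA hread hg U]
  have hfix := causalFix_isFixedPt (causal_stepMapA hblind hg U)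
  exact (congrFun hfix X).symm

/-- [folklore] **MI-R-A IS DEFINITIONAL**: any functional satisfying `RepresentsA` on the window agrees with `recA` at every
transported background. -/
theorem eq_recA_of_representsA {W : Set (ℕ → ℝ)} (hblind : M.InsBlind W) (hread : ReadsTransported M W)
    {EA : Functional C C.BgA} (hEA : M.RepresentsA EA W) {g : ℕ → ℝ} (hg : g ∈ W) (U : C.BgB) (X : C.Dom) :
    EA g (C.transport U) X = recA M g (C.transport U) X := by
  have hfixE : stepMapA M g U (tableA EA g U) = tableA EA g U := funext fun Y => (hEA g hg U Y).symm
  have hfixR : stepMapA M g U (recTableA M g U) = recTableA M g U := causalFix_isFixedPt (causal_stepMapA hblind hg U)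
  rw [recA_transport hread hg U X]
  exact apply_eq_of_isFixedPt (causal_stepMapA hblind hg U) hfixE hfixR X

/-- [folklore] Hence two functionals both satisfying `RepresentsA` agree at every transported background on the window. -/
theorem representsA_unique {W : Set (ℕ → ℝ)} (hblind : M.InsBlind W) (hread : ReadsTransported M W)
    {EA EA' : Functional C C.BgA} (hEA : M.RepresentsA EA W) (hEA' : M.RepresentsA EA' W) {g : ℕ → ℝ} (hg : g ∈ W)
    (U : C.BgB) (X : C.Dom) : EA g (C.transport U) X = EA' g (C.transport U) X := by
  rw [eq_recA_of_representsA hblind hread hEA hg U X, eq_recA_of_representsA hblind hread hEA' hg U X]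

/-- [folklore] **MI-R for a step model, assembled**: blind insertions (both runs) + the transported reading ⟹ the recursively
defined pair `(recA M, recB M)` satisfies `RepresentsA ∧ RepresentsB` on the window. -/
theorem represents_rec {W : Set (ℕ → ℝ)} (hblindA : M.InsBlind W) (hblindB : InsBlindB M W)
    (hread : ReadsTransported M W) : M.RepresentsA (recA M) W ∧ M.RepresentsB (recB M) W :=
  ⟨representsA_recA hblindA hread, representsB_recB hblindB⟩

end Runs

end Summit.QuantumFields.BalabanUV.T4Continuum.StepRecursion
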